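import Mathlib
import Literature.Computability.AlgebraicComplexity.MatrixMultiplicationExponent
import Summits.MatrixMultiplication.MatrixMultiplication.Theorems.FidelityWitnessesLinearDefectLawStubFreeUnitProduct

/-!
# `FidelityWitnesses.LinearDefectLaw`, line `border-singular-values`: `stub_unusedDirection`

Support file for crux item `stmt-MatrixMultiplication-14039`
(`Summit.MatrixMultiplication.MatrixMultiplication.Theses.FidelityWitnesses.LinearDefectLaw`), line
`border-singular-values` (reshape r1), registered stub `stub_unusedDirection` — the EASY STRATUM of
the witness law: an unused rank-one direction in some mode exhibits a unit triad on which `T − S`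
evaluates to exactly `1`.  It holds for EVERY tensor `S` (no optimality is used).

Slots: `S a b c` with `a = (κ,ν)` the output slot, `b = (κ,μ)`, `c = (μ,ν)`, all in `Fin n × Fin n`;
`T := matMulTensor ℂ n n n`, `T a b c = [a.1 = b.1 ∧ b.2 = c.1 ∧ a.2 = c.2]`.

* `stub_unusedDirection` — if a rank-one matrix `η = u v^*` (`u, v ≠ 0`) kills `S` in some mode
  (mode A: `Σ_a conj (u a.1) · v a.2 · S a b c = 0` for all `b c`; modes B, C likewise on the slots
  `b`, `c`), then there are unit vectors `x y z : Fin n × Fin n → ℂ` with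
  `1 ≤ |Σ_{abc} (T − S) abc · x a · y b · z c|` (in fact the value is exactly `1`).

Proof.  Normalise `u, v` to unit vectors `p, q` (`exists_unit_rescale`; the killed slices stay
killed, `sum_rescale_eq_zero`).  Mode A: `x a := conj (p a.1) q a.2`, `y b := p b.1 conj (p b.2)`,
`z c := p c.1 conj (q c.2)`.  These are unit product vectors (`sum_norm_sq_eq_one`); `S` vanishes on
them because the slot `a` is contracted against `p̄ ⊗ q` first (`ev_eq_zero_of_left`); and `T`
evaluates (`ev_matMulTensor`) to `Σ_{κ,ν,μ} |p κ|² |q ν|² |p μ|² = 1` (`sum_norm_sq_three`).  Modes B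
and C are the same computation with the contracted slot moved (`ev_eq_zero_of_mid`,
`ev_eq_zero_of_right`): mode B uses `y b := conj (p b.1) q b.2`, `x a := p a.1 conj (p a.2)`,
`z c := conj (q c.1) p c.2`; mode C uses `z c := conj (p c.1) q c.2`, `x a := p a.1 conj (q a.2)`,
`y b := conj (p b.1) p b.2`.  Finally `Σ (T − S) x y z = Σ T x y z − Σ S x y z = 1 − 0` (`ev_sub`).
Mathlib only, plus the tree definition `matMulTensor` and the sibling helpers
`FreeUnitProduct.ev_matMulTensor`, `FreeUnitProduct.sum_norm_sq_eq_one` (same crux, landed).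
-/

set_option linter.dupNamespace false

namespace Summit.MatrixMultiplication.MatrixMultiplication.Theorems.LinearDefectLaw.UnusedDirection

open scoped BigOperators ComplexConjugate
open Literature.Computability.AlgebraicComplexity
open Summit.MatrixMultiplication.MatrixMultiplication.Theorems.LinearDefectLaw.FreeUnitProduct
  (ev_matMulTensor sum_norm_sq_eq_one)

/-! ## Normalisation of the rank-one direction -/

/-- A nonzero vector of `ℂⁿ` has a real multiple of unit `ℓ²` norm: `Σ_i ‖r u i‖² = 1` for
`r := 1 / √(Σ_i ‖u i‖²)`. -/
theorem exists_unit_rescale {n : ℕ} {u : Fin n → ℂ} (hu : u ≠ 0) :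
    ∃ r : ℝ, ∑ i, ‖(r : ℂ) * u i‖ ^ 2 = 1 := by
  have hpos : 0 < ∑ i, ‖u i‖ ^ 2 := by
    obtain ⟨i, hi⟩ : ∃ i, u i ≠ 0 := by
      by_contra h
      push Not at h
      exact hu (funext h)
    exact lt_of_lt_of_le (by positivity) (Finset.single_le_sum (f := fun i => ‖u i‖ ^ 2)
      (fun i _ => by positivity) (Finset.mem_univ i))
  set N : ℝ := Real.sqrt (∑ i, ‖u i‖ ^ 2) with hN
  have hNpos : 0 < N := Real.sqrt_pos.2 hpos
  have hN2 : N ^ 2 = ∑ i, ‖u i‖ ^ 2 := Real.sq_sqrt hpos.le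
  refine ⟨N⁻¹, ?_⟩
  have h : ∀ i, ‖((N⁻¹ : ℝ) : ℂ) * u i‖ ^ 2 = ‖u i‖ ^ 2 / N ^ 2 := fun i => by
    rw [norm_mul, Complex.norm_real, Real.norm_of_nonneg (inv_nonneg.2 hNpos.le), mul_pow, inv_pow,
      inv_mul_eq_div]
  simp only [h]
  rw [← Finset.sum_div, ← hN2]
  exact div_self (pow_pos hNpos 2).ne'

/-- Rescaling `u ↦ r u`, `v ↦ s v` (`r, s` real) rescales the contraction `Σ conj (U a) V a R a` by
`r s`, so a killed slice stays killed. -/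
theorem sum_rescale_eq_zero {ι : Type*} [Fintype ι] (U V R : ι → ℂ) (r s : ℝ)
    (h : ∑ a, conj (U a) * V a * R a = 0) :
    ∑ a, conj ((r : ℂ) * U a) * ((s : ℂ) * V a) * R a = 0 := by
  have key : ∀ a, conj ((r : ℂ) * U a) * ((s : ℂ) * V a) * R a =
      ((r : ℂ) * s) * (conj (U a) * V a * R a) := fun a => by
    rw [map_mul, Complex.conj_ofReal]
    ring
  simp only [key]
  rw [← Finset.mul_sum, h, mul_zero]

/-! ## Trilinear evaluations -/

/-- The evaluation of a difference of tensors is the difference of the evaluations. -/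
theorem ev_sub {α β γ : Type*} [Fintype α] [Fintype β] [Fintype γ] (T S : α → β → γ → ℂ)
    (x : α → ℂ) (y : β → ℂ) (z : γ → ℂ) :
    ∑ a, ∑ b, ∑ c, (T a b c - S a b c) * x a * y b * z c =
      (∑ a, ∑ b, ∑ c, T a b c * x a * y b * z c) - ∑ a, ∑ b, ∑ c, S a b c * x a * y b * z c := by
  simp only [sub_mul, Finset.sum_sub_distrib]

/-- If `x` contracts the first slot of `S` to zero, `S` vanishes on `(x, y, z)`. -/
theorem ev_eq_zero_of_left {α β γ : Type*} [Fintype α] [Fintype β] [Fintype γ]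
    (S : α → β → γ → ℂ) (x : α → ℂ) (y : β → ℂ) (z : γ → ℂ) (h : ∀ b c, ∑ a, x a * S a b c = 0) :
    ∑ a, ∑ b, ∑ c, S a b c * x a * y b * z c = 0 := by
  calc ∑ a, ∑ b, ∑ c, S a b c * x a * y b * z c
      = ∑ b, ∑ c, (∑ a, x a * S a b c) * y b * z c := by
        rw [Finset.sum_comm]
        refine Finset.sum_congr rfl fun b _ => ?_
        rw [Finset.sum_comm]
        refine Finset.sum_congr rfl fun c _ => ?_
        rw [Finset.sum_mul, Finset.sum_mul]
        exact Finset.sum_congr rfl fun a _ => by ring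
    _ = 0 := Finset.sum_eq_zero fun b _ => Finset.sum_eq_zero fun c _ => by
        rw [h b c, zero_mul, zero_mul]

/-- If `y` contracts the second slot of `S` to zero, `S` vanishes on `(x, y, z)`. -/
theorem ev_eq_zero_of_mid {α β γ : Type*} [Fintype α] [Fintype β] [Fintype γ]
    (S : α → β → γ → ℂ) (x : α → ℂ) (y : β → ℂ) (z : γ → ℂ) (h : ∀ a c, ∑ b, y b * S a b c = 0) :
    ∑ a, ∑ b, ∑ c, S a b c * x a * y b * z c = 0 := by
  refine Finset.sum_eq_zero fun a _ => ?_
  calc ∑ b, ∑ c, S a b c * x a * y b * z c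
      = ∑ c, (∑ b, y b * S a b c) * x a * z c := by
        rw [Finset.sum_comm]
        refine Finset.sum_congr rfl fun c _ => ?_
        rw [Finset.sum_mul, Finset.sum_mul]
        exact Finset.sum_congr rfl fun b _ => by ring
    _ = 0 := Finset.sum_eq_zero fun c _ => by rw [h a c, zero_mul, zero_mul]

/-- If `z` contracts the third slot of `S` to zero, `S` vanishes on `(x, y, z)`. -/
theorem ev_eq_zero_of_right {α β γ : Type*} [Fintype α] [Fintype β] [Fintype γ]
    (S : α → β → γ → ℂ) (x : α → ℂ) (y : β → ℂ) (z : γ → ℂ) (h : ∀ a b, ∑ c, z c * S a b c = 0) :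
    ∑ a, ∑ b, ∑ c, S a b c * x a * y b * z c = 0 := by
  refine Finset.sum_eq_zero fun a _ => Finset.sum_eq_zero fun b _ => ?_
  calc ∑ c, S a b c * x a * y b * z c = (∑ c, z c * S a b c) * x a * y b := by
        rw [Finset.sum_mul, Finset.sum_mul]
        exact Finset.sum_congr rfl fun c _ => by ring
    _ = 0 := by rw [h a b, zero_mul, zero_mul]

/-- `Σ_{(κ,ν)} Σ_μ ‖f κ‖² ‖g ν‖² ‖h μ‖² = 1` (as complex numbers) for unit vectors `f, g, h`. -/
theorem sum_norm_sq_three {n : ℕ} (f g h : Fin n → ℂ) (hf : ∑ i, ‖f i‖ ^ 2 = 1)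
    (hg : ∑ i, ‖g i‖ ^ 2 = 1) (hh : ∑ i, ‖h i‖ ^ 2 = 1) :
    ∑ a : Fin n × Fin n, ∑ μ : Fin n, (‖f a.1‖ : ℂ) ^ 2 * (‖g a.2‖ : ℂ) ^ 2 * (‖h μ‖ : ℂ) ^ 2 = 1 := by
  have hfC : ∑ i, (‖f i‖ : ℂ) ^ 2 = 1 := by exact_mod_cast hf
  have hgC : ∑ i, (‖g i‖ : ℂ) ^ 2 = 1 := by exact_mod_cast hg
  have hhC : ∑ i, (‖h i‖ : ℂ) ^ 2 = 1 := by exact_mod_cast hh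
  calc ∑ a : Fin n × Fin n, ∑ μ : Fin n, (‖f a.1‖ : ℂ) ^ 2 * (‖g a.2‖ : ℂ) ^ 2 * (‖h μ‖ : ℂ) ^ 2
      = (∑ κ, (‖f κ‖ : ℂ) ^ 2) * (∑ ν, (‖g ν‖ : ℂ) ^ 2) * ∑ μ, (‖h μ‖ : ℂ) ^ 2 := by
        rw [Fintype.sum_prod_type, Finset.sum_mul_sum]
        simp_rw [Finset.sum_mul, Finset.mul_sum]
    _ = 1 := by rw [hfC, hgC, hhC, one_mul, one_mul]

/-! ## The three modes, for unit `p, q` -/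

/-- Mode A (slot `a` killed by `p̄ ⊗ q`, `p, q` unit): the unit triad `x = p̄ ⊗ q`, `y = p ⊗ p̄`,
`z = p ⊗ q̄` has `Σ S x y z = 0` and `Σ T x y z = 1`. -/
theorem modeA {n : ℕ} (S : Fin n × Fin n → Fin n × Fin n → Fin n × Fin n → ℂ) (p q : Fin n → ℂ)
    (hp : ∑ i, ‖p i‖ ^ 2 = 1) (hq : ∑ i, ‖q i‖ ^ 2 = 1)
    (h : ∀ b c : Fin n × Fin n, (∑ a : Fin n × Fin n, conj (p a.1) * q a.2 * S a b c) = 0) :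
    ∃ x y z : Fin n × Fin n → ℂ, (∑ i, ‖x i‖ ^ 2) = 1 ∧ (∑ i, ‖y i‖ ^ 2) = 1 ∧
      (∑ i, ‖z i‖ ^ 2) = 1 ∧ (∑ a, ∑ b, ∑ c, S a b c * x a * y b * z c) = 0 ∧
      (∑ a, ∑ b, ∑ c, matMulTensor ℂ n n n a b c * x a * y b * z c) = 1 := by
  have h1 : ∑ a : Fin n × Fin n, ‖conj (p a.1) * q a.2‖ ^ 2 = 1 :=
    sum_norm_sq_eq_one _ p q (fun a => by rw [norm_mul, Complex.norm_conj]) hp hq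
  have h2 : ∑ b : Fin n × Fin n, ‖p b.1 * conj (p b.2)‖ ^ 2 = 1 :=
    sum_norm_sq_eq_one _ p p (fun b => by rw [norm_mul, Complex.norm_conj]) hp hp
  have h3 : ∑ c : Fin n × Fin n, ‖p c.1 * conj (q c.2)‖ ^ 2 = 1 :=
    sum_norm_sq_eq_one _ p q (fun c => by rw [norm_mul, Complex.norm_conj]) hp hq
  have h4 : ∑ a, ∑ b, ∑ c, S a b c * (conj (p a.1) * q a.2) * (p b.1 * conj (p b.2)) *
      (p c.1 * conj (q c.2)) = 0 :=
    ev_eq_zero_of_left S (fun a => conj (p a.1) * q a.2) (fun b => p b.1 * conj (p b.2))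
      (fun c => p c.1 * conj (q c.2)) h
  have h5 : ∑ a, ∑ b, ∑ c, matMulTensor ℂ n n n a b c * (conj (p a.1) * q a.2) *
      (p b.1 * conj (p b.2)) * (p c.1 * conj (q c.2)) = 1 := by
    calc _ = ∑ a : Fin n × Fin n, ∑ μ : Fin n,
          conj (p a.1) * q a.2 * (p a.1 * conj (p μ)) * (p μ * conj (q a.2)) :=
          ev_matMulTensor (fun a => conj (p a.1) * q a.2) (fun b => p b.1 * conj (p b.2))
            (fun c => p c.1 * conj (q c.2))
      _ = ∑ a : Fin n × Fin n, ∑ μ : Fin n,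
          (‖p a.1‖ : ℂ) ^ 2 * (‖q a.2‖ : ℂ) ^ 2 * (‖p μ‖ : ℂ) ^ 2 := by
          refine Finset.sum_congr rfl fun a _ => Finset.sum_congr rfl fun μ _ => ?_
          rw [← Complex.mul_conj', ← Complex.mul_conj', ← Complex.mul_conj']
          ring
      _ = 1 := sum_norm_sq_three p q p hp hq hp
  exact ⟨fun a => conj (p a.1) * q a.2, fun b => p b.1 * conj (p b.2), fun c => p c.1 * conj (q c.2),
    h1, h2, h3, h4, h5⟩

/-- Mode B (slot `b` killed by `p̄ ⊗ q`, `p, q` unit): the unit triad `x = p ⊗ p̄`, `y = p̄ ⊗ q`,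
`z = q̄ ⊗ p` has `Σ S x y z = 0` and `Σ T x y z = 1`. -/
theorem modeB {n : ℕ} (S : Fin n × Fin n → Fin n × Fin n → Fin n × Fin n → ℂ) (p q : Fin n → ℂ)
    (hp : ∑ i, ‖p i‖ ^ 2 = 1) (hq : ∑ i, ‖q i‖ ^ 2 = 1)
    (h : ∀ a c : Fin n × Fin n, (∑ b : Fin n × Fin n, conj (p b.1) * q b.2 * S a b c) = 0) :
    ∃ x y z : Fin n × Fin n → ℂ, (∑ i, ‖x i‖ ^ 2) = 1 ∧ (∑ i, ‖y i‖ ^ 2) = 1 ∧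
      (∑ i, ‖z i‖ ^ 2) = 1 ∧ (∑ a, ∑ b, ∑ c, S a b c * x a * y b * z c) = 0 ∧
      (∑ a, ∑ b, ∑ c, matMulTensor ℂ n n n a b c * x a * y b * z c) = 1 := by
  have h1 : ∑ a : Fin n × Fin n, ‖p a.1 * conj (p a.2)‖ ^ 2 = 1 :=
    sum_norm_sq_eq_one _ p p (fun a => by rw [norm_mul, Complex.norm_conj]) hp hp
  have h2 : ∑ b : Fin n × Fin n, ‖conj (p b.1) * q b.2‖ ^ 2 = 1 :=
    sum_norm_sq_eq_one _ p q (fun b => by rw [norm_mul, Complex.norm_conj]) hp hq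
  have h3 : ∑ c : Fin n × Fin n, ‖conj (q c.1) * p c.2‖ ^ 2 = 1 :=
    sum_norm_sq_eq_one _ q p (fun c => by rw [norm_mul, Complex.norm_conj]) hq hp
  have h4 : ∑ a, ∑ b, ∑ c, S a b c * (p a.1 * conj (p a.2)) * (conj (p b.1) * q b.2) *
      (conj (q c.1) * p c.2) = 0 :=
    ev_eq_zero_of_mid S (fun a => p a.1 * conj (p a.2)) (fun b => conj (p b.1) * q b.2)
      (fun c => conj (q c.1) * p c.2) h
  have h5 : ∑ a, ∑ b, ∑ c, matMulTensor ℂ n n n a b c * (p a.1 * conj (p a.2)) *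
      (conj (p b.1) * q b.2) * (conj (q c.1) * p c.2) = 1 := by
    calc _ = ∑ a : Fin n × Fin n, ∑ μ : Fin n,
          p a.1 * conj (p a.2) * (conj (p a.1) * q μ) * (conj (q μ) * p a.2) :=
          ev_matMulTensor (fun a => p a.1 * conj (p a.2)) (fun b => conj (p b.1) * q b.2)
            (fun c => conj (q c.1) * p c.2)
      _ = ∑ a : Fin n × Fin n, ∑ μ : Fin n,
          (‖p a.1‖ : ℂ) ^ 2 * (‖p a.2‖ : ℂ) ^ 2 * (‖q μ‖ : ℂ) ^ 2 := by
          refine Finset.sum_congr rfl fun a _ => Finset.sum_congr rfl fun μ _ => ?_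
          rw [← Complex.mul_conj', ← Complex.mul_conj', ← Complex.mul_conj']
          ring
      _ = 1 := sum_norm_sq_three p p q hp hp hq
  exact ⟨fun a => p a.1 * conj (p a.2), fun b => conj (p b.1) * q b.2, fun c => conj (q c.1) * p c.2,
    h1, h2, h3, h4, h5⟩

/-- Mode C (slot `c` killed by `p̄ ⊗ q`, `p, q` unit): the unit triad `x = p ⊗ q̄`, `y = p̄ ⊗ p`,
`z = p̄ ⊗ q` has `Σ S x y z = 0` and `Σ T x y z = 1`. -/
theorem modeC {n : ℕ} (S : Fin n × Fin n → Fin n × Fin n → Fin n × Fin n → ℂ) (p q : Fin n → ℂ)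
    (hp : ∑ i, ‖p i‖ ^ 2 = 1) (hq : ∑ i, ‖q i‖ ^ 2 = 1)
    (h : ∀ a b : Fin n × Fin n, (∑ c : Fin n × Fin n, conj (p c.1) * q c.2 * S a b c) = 0) :
    ∃ x y z : Fin n × Fin n → ℂ, (∑ i, ‖x i‖ ^ 2) = 1 ∧ (∑ i, ‖y i‖ ^ 2) = 1 ∧
      (∑ i, ‖z i‖ ^ 2) = 1 ∧ (∑ a, ∑ b, ∑ c, S a b c * x a * y b * z c) = 0 ∧
      (∑ a, ∑ b, ∑ c, matMulTensor ℂ n n n a b c * x a * y b * z c) = 1 := by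
  have h1 : ∑ a : Fin n × Fin n, ‖p a.1 * conj (q a.2)‖ ^ 2 = 1 :=
    sum_norm_sq_eq_one _ p q (fun a => by rw [norm_mul, Complex.norm_conj]) hp hq
  have h2 : ∑ b : Fin n × Fin n, ‖conj (p b.1) * p b.2‖ ^ 2 = 1 :=
    sum_norm_sq_eq_one _ p p (fun b => by rw [norm_mul, Complex.norm_conj]) hp hp
  have h3 : ∑ c : Fin n × Fin n, ‖conj (p c.1) * q c.2‖ ^ 2 = 1 :=
    sum_norm_sq_eq_one _ p q (fun c => by rw [norm_mul, Complex.norm_conj]) hp hq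
  have h4 : ∑ a, ∑ b, ∑ c, S a b c * (p a.1 * conj (q a.2)) * (conj (p b.1) * p b.2) *
      (conj (p c.1) * q c.2) = 0 :=
    ev_eq_zero_of_right S (fun a => p a.1 * conj (q a.2)) (fun b => conj (p b.1) * p b.2)
      (fun c => conj (p c.1) * q c.2) h
  have h5 : ∑ a, ∑ b, ∑ c, matMulTensor ℂ n n n a b c * (p a.1 * conj (q a.2)) *
      (conj (p b.1) * p b.2) * (conj (p c.1) * q c.2) = 1 := by
    calc _ = ∑ a : Fin n × Fin n, ∑ μ : Fin n,
          p a.1 * conj (q a.2) * (conj (p a.1) * p μ) * (conj (p μ) * q a.2) :=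
          ev_matMulTensor (fun a => p a.1 * conj (q a.2)) (fun b => conj (p b.1) * p b.2)
            (fun c => conj (p c.1) * q c.2)
      _ = ∑ a : Fin n × Fin n, ∑ μ : Fin n,
          (‖p a.1‖ : ℂ) ^ 2 * (‖q a.2‖ : ℂ) ^ 2 * (‖p μ‖ : ℂ) ^ 2 := by
          refine Finset.sum_congr rfl fun a _ => Finset.sum_congr rfl fun μ _ => ?_
          rw [← Complex.mul_conj', ← Complex.mul_conj', ← Complex.mul_conj']
          ring
      _ = 1 := sum_norm_sq_three p q p hp hq hp
  exact ⟨fun a => p a.1 * conj (q a.2), fun b => conj (p b.1) * p b.2, fun c => conj (p c.1) * q c.2,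
    h1, h2, h3, h4, h5⟩

/-! ## The stub -/

/-- stub `stub_unusedDirection` of line `border-singular-values` (reshape r1) for crux
`LinearDefectLaw` (stmt-MatrixMultiplication-14039): an unused rank-one direction in some mode
exhibits a unit triad on which T − S is exactly 1 (card critical-compression-normal-form, lemma L2).
Precisely: if `u, v ≠ 0` and `ū ⊗ v` contracts slot `a` (resp. `b`, `c`) of `S` to zero, then some
unit vectors `x y z : Fin n × Fin n → ℂ` have `1 ≤ |Σ_{abc} (⟨n,n,n⟩ − S) abc · x a · y b · z c|`;
the witnesses are the unit product triads of `modeA` / `modeB` / `modeC` for the normalised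
`p = u/‖u‖`, `q = v/‖v‖`, on which `S` vanishes and `⟨n,n,n⟩` evaluates to `1`. -/
theorem stub_unusedDirection :
    ∀ (n : ℕ) (S : Fin n × Fin n → Fin n × Fin n → Fin n × Fin n → ℂ),
      ((∃ u v : Fin n → ℂ, u ≠ 0 ∧ v ≠ 0 ∧
          ∀ b c : Fin n × Fin n, (∑ a : Fin n × Fin n, (starRingEnd ℂ) (u a.1) * v a.2 * S a b c) = 0) ∨
        (∃ u v : Fin n → ℂ, u ≠ 0 ∧ v ≠ 0 ∧
          ∀ a c : Fin n × Fin n, (∑ b : Fin n × Fin n, (starRingEnd ℂ) (u b.1) * v b.2 * S a b c) = 0) ∨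
        (∃ u v : Fin n → ℂ, u ≠ 0 ∧ v ≠ 0 ∧
          ∀ a b : Fin n × Fin n, (∑ c : Fin n × Fin n, (starRingEnd ℂ) (u c.1) * v c.2 * S a b c) = 0)) →
      ∃ x y z : Fin n × Fin n → ℂ, (∑ i, ‖x i‖ ^ 2) = 1 ∧ (∑ i, ‖y i‖ ^ 2) = 1 ∧ (∑ i, ‖z i‖ ^ 2) = 1 ∧
        1 ≤ ‖∑ a, ∑ b, ∑ c, (matMulTensor ℂ n n n a b c - S a b c) * x a * y b * z c‖ := by
  intro n S hS
  -- it suffices to find a unit triad on which `S` vanishes and `⟨n,n,n⟩` evaluates to `1`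
  suffices H : ∃ x y z : Fin n × Fin n → ℂ, (∑ i, ‖x i‖ ^ 2) = 1 ∧ (∑ i, ‖y i‖ ^ 2) = 1 ∧
      (∑ i, ‖z i‖ ^ 2) = 1 ∧ (∑ a, ∑ b, ∑ c, S a b c * x a * y b * z c) = 0 ∧
      (∑ a, ∑ b, ∑ c, matMulTensor ℂ n n n a b c * x a * y b * z c) = 1 by
    obtain ⟨x, y, z, hx, hy, hz, h0, h1⟩ := H
    refine ⟨x, y, z, hx, hy, hz, le_of_eq ?_⟩
    rw [ev_sub, h0, h1, sub_zero, norm_one]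
  rcases hS with ⟨u, v, hu, hv, h⟩ | ⟨u, v, hu, hv, h⟩ | ⟨u, v, hu, hv, h⟩
  · -- mode A: normalise and apply `modeA`
    obtain ⟨r, hr⟩ := exists_unit_rescale hu
    obtain ⟨s, hs⟩ := exists_unit_rescale hv
    have h' : ∀ b c : Fin n × Fin n,
        (∑ a : Fin n × Fin n, conj ((r : ℂ) * u a.1) * ((s : ℂ) * v a.2) * S a b c) = 0 := fun b c =>
      sum_rescale_eq_zero (fun a : Fin n × Fin n => u a.1) (fun a : Fin n × Fin n => v a.2)
        (fun a : Fin n × Fin n => S a b c) r s (h b c)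
    exact modeA S (fun i => (r : ℂ) * u i) (fun i => (s : ℂ) * v i) hr hs h'
  · -- mode B
    obtain ⟨r, hr⟩ := exists_unit_rescale hu
    obtain ⟨s, hs⟩ := exists_unit_rescale hv
    have h' : ∀ a c : Fin n × Fin n,
        (∑ b : Fin n × Fin n, conj ((r : ℂ) * u b.1) * ((s : ℂ) * v b.2) * S a b c) = 0 := fun a c =>
      sum_rescale_eq_zero (fun b : Fin n × Fin n => u b.1) (fun b : Fin n × Fin n => v b.2)
        (fun b : Fin n × Fin n => S a b c) r s (h a c)
    exact modeB S (fun i => (r : ℂ) * u i) (fun i => (s : ℂ) * v i) hr hs h'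
  · -- mode C
    obtain ⟨r, hr⟩ := exists_unit_rescale hu
    obtain ⟨s, hs⟩ := exists_unit_rescale hv
    have h' : ∀ a b : Fin n × Fin n,
        (∑ c : Fin n × Fin n, conj ((r : ℂ) * u c.1) * ((s : ℂ) * v c.2) * S a b c) = 0 := fun a b =>
      sum_rescale_eq_zero (fun c : Fin n × Fin n => u c.1) (fun c : Fin n × Fin n => v c.2)
        (fun c : Fin n × Fin n => S a b c) r s (h a b)
    exact modeC S (fun i => (r : ℂ) * u i) (fun i => (s : ℂ) * v i) hr hs h'

end Summit.MatrixMultiplication.MatrixMultiplication.Theorems.LinearDefectLaw.UnusedDirection
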